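import Summits.QuantumFields.BalabanUV.Beta.GAN24.OneStepConstraintAxialLetters
import Summits.QuantumFields.BalabanUV.Beta.GAN24.OneStepConstraintLocalisation
import Summits.QuantumFields.BalabanUV.Beta.GAN24.DerivativeRateTransferKKTSourcesEnd

/-!
# `BalabanUV.Beta.GAN24.OneStepConstraintBlockGeometry` — binder row G-an2-4 ∕ (CONV-C), routes C-R6° («VALUES») × R7 («TWO CURRENCIES»), PART 181 (file 1 of 2):
# THREE MODEL-SIDE LETTERS OF PART 180's ENDs, GENERICALLY: (i) the torus sup-distance of two fine sites dominates `R` times the distance of their BLOCK PARENTS up to `R − 1`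
# (`R·tdist(par x, par x′) ≤ tdist(x,x′) + (R − 1)`), so entry decay in the fine-site distance IS entry decay in the block distance (`h₀ ↦ h₀e^{δ(R−1)}`, `δ ↦ δR`);
# (ii) entry decay in the block distance gives the trial-form upper bound `⟨u,Hu⟩ ≤ h₀·(d·R^d·Kf(δ_H))·|u|²` (Schur test); (iii) the axial tree AVOIDS THE TOP CORNERS
# (PART 180's `hι`) — census V200″ (δ), the dictionary half  (unit b2b-balaban-gan24-p3, gen 60; v1)

NOT IN PRINT; OUR PROOF ([folklore] bookkeeping BY NAME over `Beta.VectorTails` (`liftZ`, `castT`, `castT_liftZ`), `Beta.VectorTailsCov` (`tdist`, `supNorm_liftZ_le_of_castT_eq` — the centred lift is the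
smallest representative), `Beta.PoissonInterior` (`supNorm`, `supNorm_le_iff`, `natAbs_le_supNorm`), NE2's `BalabanAveragedTowerModes` (`par`, `rem`, `val_par`), PART 170
`OneStepConstraintLocalisation.sumBound_fine`, and road P3's Schur test `DerivativeRateTransferKKTSourcesEnd.form_le_of_abs_rowSum_le`.  Nothing printed is a hypothesis;
[Balaban1984PropagatorsII] p. 250 («C*Δ_kC has the same exponential decay as Δ_k») LOCATES why the block reading of a fine decay is wanted.)
HONEST FRAMING (cell contract, verbatim): «discharging `BetaPertH` makes Bałaban's UV stability UNCONDITIONAL — a real constructive-QFT result; it is NOT the continuum limit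
and NOT the Clay problem.»  HONEST DEPENDENCY (verbatim): «continuum YM on T⁴ ⇐ BetaPertH ∧ nine spine estimates (0/9 proved); BetaPertH ⇐ (D1) ∧ (D4) ∧ CAP+tail; G-an2-4 gates
asym, D1 and NE2/3/4.»

WHY (census V200″ (δ), gen 59 ∕ 60).  PART 180 (`OneStepConstraintAxialGauges` ∕ `OneStepConstraintAxialLocalisation`) localises the three blocks `𝒮, ℋ, 𝒢` of the GAUGE-FIXED one-loop
step for every fine form `H` with letters `(h, h₀, δ_H)` in the BLOCK distance `tdist(par x, par x′)` and every corner-avoiding bond family.  For `H = re Δ_k` the tree supplies the entry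
decay in the FINE-SITE distance (`B6Cov2156TorusDelK.re_DelK_decay`, `AveragedPropagatorInverseUniform.exists_DelK_kernel_decay`: d-only constants, every level, every torus); THIS FILE is the
dictionary that turns such a decay into PART 180's letters `hHent` (§1) and `hHub` (§2), and checks `hι` for the axial tree (§3).  File 2 (`OneStepConstraintAxialDelK`) instantiates.

WHAT THIS FILE PROVES (0 sorry, 0 `def`; `N, R ≥ 1`, every torus `M`, every `d`):
* §1 `exists_val_sub_val_eq` (the centred lift of `x′ − x` vs the difference of values, mod the period), **`mul_tdist_par_le`** (`R·tdist(par x, par x′) ≤ tdist(x, x′) + (R − 1)` — the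
  integer vector `⌊x′∕R⌋ − ⌊x∕R⌋ − (period∕R)·m` represents `par x′ − par x` and has sup norm `≤ (tdist(x,x′) + R − 1)∕R`; minimality of the centred lift), `cast_mul_tdist_par_le` (in `ℝ`),
  **`exp_neg_tdist_le`** (`e^{−δ·tdist(x,x′)} ≤ e^{δ(R−1)}·e^{−δR·tdist(par x, par x′)}`), **`entry_decay_par_of_fine`** (`|H(x,x′)| ≤ h₀e^{−δ·tdist(x.1,x′.1)}` ⟹
  `|H(x,x′)| ≤ h₀e^{δ(R−1)}·e^{−(δR)·tdist(par x.1, par x′.1)}` — PART 180's `hHent`).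
* §2 `abs_rowSum_le_of_entry_decay_par`, **`form_le_of_entry_decay_par`** — `H` symmetric with `|H(x,x′)| ≤ h₀e^{−δ_H·tdist(par x.1, par x′.1)}` and a site profile `Kf` ⟹ `⟨u,Hu⟩ ≤ h₀·(d·R^d·Kf(δ_H))·|u|²` (PART 180's `hHub`;
  Schur test + PART 170 `sumBound_fine`).
* §3 **`not_corner_of_tree`** — a tree bond `(rem_μ x + 1 < R)` is not a top-corner bond (`rem ≡ R − 1`): PART 180's `hι` for `ι = Function.Embedding.subtype (tree)`.
WHAT IT IS NOT: no statement about `Δ_k` here (file 2); nothing printed is discharged or assumed.  SUPPLIER work; NEVER «G-an2-4 closed»; NOT (CONV-C), NOT D1, NOT `BetaPertH`,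
NOT continuum, NOT Clay.  Records: `HOME/b2b-balaban-gan24-p3/gen60/README.md`.
-/

noncomputable section

open scoped BigOperators Matrix
open Finset Matrix

namespace Summit.QuantumFields.BalabanUV.Beta.GAN24.OneStepConstraintBlockGeometry

open Literature.MathematicalPhysics.QuantumFieldTheory.Balaban1983to89
open Literature.MathematicalPhysics.QuantumFieldTheory.Balaban1983to89.B5Prop11Plancherel (Tor fine)
open Literature.MathematicalPhysics.QuantumFieldTheory.Balaban1983to89.Beta.PoissonInterior (supNorm supNorm_le_iff natAbs_le_supNorm)
open Literature.MathematicalPhysics.QuantumFieldTheory.Balaban1983to89.Beta.VectorTails (liftZ castT castT_liftZ)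
open Literature.MathematicalPhysics.QuantumFieldTheory.Balaban1983to89.Beta.VectorTailsCov (tdist tdist_self tdist_triangle tdist_comm supNorm_liftZ_le_of_castT_eq)
open Summit.QuantumFields.BalabanUV.T4Continuum.BalabanAveragedTowerModes (par rem val_par)
open Summit.QuantumFields.BalabanUV.Beta.GAN24.OneStepConstraintLocalisation (sumBound_fine)
open Summit.QuantumFields.BalabanUV.Beta.GAN24.DerivativeRateTransferKKTSourcesEnd (form_le_of_abs_rowSum_le)

variable {d : ℕ} (N R : ℕ) [NeZero N] [NeZero R] (M : Fin d → ℕ) [hM : ∀ μ, NeZero (M μ)]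

/-! ## §1 Fine-site distance versus block distance -/

section Distance

/-- coordinatewise, the centred lift of `x′ − x` IS the difference of the values up to a multiple of the period:
`val x′_ν − val x_ν = liftZ(x′ − x)_ν + (R·N·M_ν)·m`. [folklore] -/
theorem exists_val_sub_val_eq (x x' : Tor (fine (R * N) M)) (ν : Fin d) :
    ∃ m : ℤ, (((x' ν).val : ℕ) : ℤ) - (((x ν).val : ℕ) : ℤ) = liftZ (x' - x) ν + (fine (R * N) M ν : ℤ) * m := by
  have h1 : ((liftZ (x' - x) ν : ℤ) : ZMod (fine (R * N) M ν)) = x' ν - x ν := by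
    have h := congrFun (castT_liftZ (x' - x)) ν
    simpa only [castT, Pi.sub_apply] using h
  have h2 : ((((((x' ν).val : ℕ) : ℤ) - (((x ν).val : ℕ) : ℤ) - liftZ (x' - x) ν : ℤ)) : ZMod (fine (R * N) M ν)) = 0 := by
    push_cast
    rw [h1, ZMod.natCast_zmod_val, ZMod.natCast_zmod_val, sub_self]
  obtain ⟨m, hm⟩ := (ZMod.intCast_zmod_eq_zero_iff_dvd _ _).mp h2
  exact ⟨m, by linarith [hm]⟩

/-- **`mul_tdist_par_le` — THE BLOCK DISTANCE IS DOMINATED BY THE FINE-SITE DISTANCE**: `R·tdist(par x, par x′) ≤ tdist(x, x′) + (R − 1)` for all fine sites `x, x′` of the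
`R`-blocked torus (the vector `w_ν = ⌊val x′_ν∕R⌋ − ⌊val x_ν∕R⌋ − (N·M_ν)·m_ν` represents `par x′ − par x` and `R·|w_ν| ≤ |liftZ(x′−x)_ν| + (R − 1)`; the centred lift is minimal).
[folklore] -/
theorem mul_tdist_par_le (x x' : Tor (fine (R * N) M)) : R * tdist (par N R M x) (par N R M x') ≤ tdist x x' + (R - 1) := by
  have hR : 0 < R := Nat.pos_of_ne_zero (NeZero.ne R)
  choose m hm using exists_val_sub_val_eq N R M x x'
  -- the representative of `par x′ − par x`
  set w : Fin d → ℤ := fun ν => ((((x' ν).val / R : ℕ) : ℤ)) - ((((x ν).val / R : ℕ) : ℤ)) - (fine N M ν : ℤ) * m ν with hw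
  have hcast : castT (fine N M) w = par N R M x' - par N R M x := by
    funext ν
    rw [Pi.sub_apply, ← ZMod.natCast_zmod_val (par N R M x' ν), ← ZMod.natCast_zmod_val (par N R M x ν), val_par, val_par]
    simp only [castT, hw, Int.cast_sub, Int.cast_mul, Int.cast_natCast, ZMod.natCast_self, zero_mul, sub_zero]
  -- coordinatewise bound `R·|w_ν| ≤ |liftZ_ν| + (R − 1)`
  have hcoord : ∀ ν, R * (w ν).natAbs ≤ (liftZ (x' - x) ν).natAbs + (R - 1) := by
    intro ν
    have hdm : (R : ℤ) * ((((x ν).val / R : ℕ) : ℤ)) + ((((x ν).val % R : ℕ) : ℤ)) = (((x ν).val : ℕ) : ℤ) := by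
      exact_mod_cast Nat.div_add_mod ((x ν).val) R
    have hdm' : (R : ℤ) * ((((x' ν).val / R : ℕ) : ℤ)) + ((((x' ν).val % R : ℕ) : ℤ)) = (((x' ν).val : ℕ) : ℤ) := by
      exact_mod_cast Nat.div_add_mod ((x' ν).val) R
    have hr : (((x ν).val % R : ℕ) : ℤ) < R := by exact_mod_cast Nat.mod_lt _ hR
    have hr' : (((x' ν).val % R : ℕ) : ℤ) < R := by exact_mod_cast Nat.mod_lt _ hR
    have hr0 : (0 : ℤ) ≤ (((x ν).val % R : ℕ) : ℤ) := by exact_mod_cast Nat.zero_le _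
    have hr0' : (0 : ℤ) ≤ (((x' ν).val % R : ℕ) : ℤ) := by exact_mod_cast Nat.zero_le _
    have hfine : (fine (R * N) M ν : ℤ) = (R : ℤ) * (fine N M ν : ℤ) := by
      simp only [fine]; push_cast; ring
    have key : (R : ℤ) * w ν = liftZ (x' - x) ν - ((((x' ν).val % R : ℕ) : ℤ)) + ((((x ν).val % R : ℕ) : ℤ)) := by
      have e : (R : ℤ) * w ν = (R : ℤ) * ((((x' ν).val / R : ℕ) : ℤ)) - (R : ℤ) * ((((x ν).val / R : ℕ) : ℤ)) - (R : ℤ) * (fine N M ν : ℤ) * m ν := by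
        rw [hw]; ring
      rw [e, ← hfine]
      linarith [hm ν, hdm, hdm']
    have habs : |(R : ℤ) * w ν| ≤ |liftZ (x' - x) ν| + ((R : ℤ) - 1) := by
      rw [key]
      rcases abs_cases (liftZ (x' - x) ν - ((((x' ν).val % R : ℕ) : ℤ)) + ((((x ν).val % R : ℕ) : ℤ))) with ⟨h1, _⟩ | ⟨h1, _⟩ <;>
        rcases abs_cases (liftZ (x' - x) ν) with ⟨h2, _⟩ | ⟨h2, _⟩ <;> rw [h1, h2] <;> linarith
    rw [abs_mul, Nat.abs_cast] at habs
    have hR1 : 1 ≤ R := hR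
    zify [hR1]
    exact habs
  -- sup over coordinates
  have hsup : supNorm w ≤ (tdist x x' + (R - 1)) / R := by
    refine supNorm_le_iff.mpr fun ν => (Nat.le_div_iff_mul_le hR).mpr ?_
    rw [mul_comm]
    exact (hcoord ν).trans (Nat.add_le_add_right (natAbs_le_supNorm (liftZ (x' - x)) ν) _)
  calc R * tdist (par N R M x) (par N R M x') ≤ R * supNorm w := Nat.mul_le_mul_left R (supNorm_liftZ_le_of_castT_eq hcast)
    _ ≤ R * ((tdist x x' + (R - 1)) / R) := Nat.mul_le_mul_left R hsup
    _ ≤ tdist x x' + (R - 1) := Nat.mul_div_le _ _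

/-- the same in `ℝ`: `R·tdist(par x, par x′) ≤ tdist(x,x′) + (R − 1)`. [folklore] -/
theorem cast_mul_tdist_par_le (x x' : Tor (fine (R * N) M)) :
    (R : ℝ) * (tdist (par N R M x) (par N R M x') : ℝ) ≤ (tdist x x' : ℝ) + ((R : ℝ) - 1) := by
  have hR : 1 ≤ R := Nat.pos_of_ne_zero (NeZero.ne R)
  have h := mul_tdist_par_le N R M x x'
  have hc : (((R - 1 : ℕ)) : ℝ) = (R : ℝ) - 1 := by rw [Nat.cast_sub hR, Nat.cast_one]
  rw [← hc]
  exact_mod_cast h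

/-- **`exp_neg_tdist_le` — A FINE-SITE DECAY IS A BLOCK DECAY**: `e^{−δ·tdist(x,x′)} ≤ e^{δ(R−1)}·e^{−(δR)·tdist(par x, par x′)}` for `δ ≥ 0`. [folklore] -/
theorem exp_neg_tdist_le {δ : ℝ} (hδ : 0 ≤ δ) (x x' : Tor (fine (R * N) M)) :
    Real.exp (-(δ * (tdist x x' : ℝ))) ≤ Real.exp (δ * ((R : ℝ) - 1)) * Real.exp (-(δ * R * (tdist (par N R M x) (par N R M x') : ℝ))) := by
  rw [← Real.exp_add]
  apply Real.exp_le_exp.mpr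
  have h := cast_mul_tdist_par_le N R M x x'
  nlinarith

/-- **`entry_decay_par_of_fine` — PART 180's LETTER `hHent` FROM A FINE-SITE ENTRY DECAY**: `|H(x,x′)| ≤ h₀e^{−δ·tdist(x.1,x′.1)}` (`h₀, δ ≥ 0`) ⟹
`|H(x,x′)| ≤ h₀e^{δ(R−1)}·e^{−(δR)·tdist(par x.1, par x′.1)}`. [folklore] -/
theorem entry_decay_par_of_fine {α : Type*} {H : (Tor (fine (R * N) M) × α) → (Tor (fine (R * N) M) × α) → ℝ} {h₀ δ : ℝ} (hh₀ : 0 ≤ h₀) (hδ : 0 ≤ δ)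
    (hH : ∀ x x', |H x x'| ≤ h₀ * Real.exp (-(δ * (tdist x.1 x'.1 : ℝ)))) (x x' : Tor (fine (R * N) M) × α) :
    |H x x'| ≤ h₀ * Real.exp (δ * ((R : ℝ) - 1)) * Real.exp (-(δ * R * (tdist (par N R M x.1) (par N R M x'.1) : ℝ))) := by
  rw [mul_assoc]
  exact (hH x x').trans (mul_le_mul_of_nonneg_left (exp_neg_tdist_le N R M hδ x.1 x'.1) hh₀)

end Distance

/-! ## §2 Entry decay in the block distance gives the trial-form upper bound (Schur test) -/

section Schur

variable {H : Matrix (Tor (fine (R * N) M) × Fin d) (Tor (fine (R * N) M) × Fin d) ℝ} {Kf : ℝ → ℝ}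

/-- the absolute row sums of a block-decaying fine form: `Σ_{x′} |H(x,x′)| ≤ h₀·(d·R^d·Kf(δ_H))` (PART 170 `sumBound_fine`). [folklore] -/
theorem abs_rowSum_le_of_entry_decay_par
    (hKf : ∀ s : ℝ, 0 < s → ∀ y : Tor (fine N M), ∑ y' : Tor (fine N M), Real.exp (-(s * (tdist y y' : ℝ))) ≤ Kf s)
    {h₀ δH : ℝ} (hh₀ : 0 ≤ h₀) (hδH : 0 < δH)
    (hHent : ∀ x x', |H x x'| ≤ h₀ * Real.exp (-(δH * (tdist (par N R M x.1) (par N R M x'.1) : ℝ)))) (x : Tor (fine (R * N) M) × Fin d) :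
    ∑ x', |H x x'| ≤ h₀ * ((d : ℝ) * (R : ℝ) ^ d * Kf δH) := by
  have hS : ∑ x' : Tor (fine (R * N) M) × Fin d, Real.exp (-(δH * (tdist (par N R M x.1) (par N R M x'.1) : ℝ))) ≤ (d : ℝ) * (R : ℝ) ^ d * Kf δH :=
    sumBound_fine N R M hKf δH hδH x
  have h1 : ∑ x', |H x x'| ≤ ∑ x' : Tor (fine (R * N) M) × Fin d, h₀ * Real.exp (-(δH * (tdist (par N R M x.1) (par N R M x'.1) : ℝ))) :=
    Finset.sum_le_sum fun x' _ => hHent x x'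
  rw [← Finset.mul_sum] at h1
  exact h1.trans (mul_le_mul_of_nonneg_left hS hh₀)

/-- **`form_le_of_entry_decay_par` — PART 180's LETTER `hHub` FROM `hHent`**: a symmetric fine form with `|H(x,x′)| ≤ h₀e^{−δ_H·tdist(par x.1, par x′.1)}` (`h₀ ≥ 0`, `δ_H > 0`)
and a site profile `Σ_{y′} e^{−s·tdist(y,y′)} ≤ Kf(s)` on the coarse torus satisfies `⟨u,Hu⟩ ≤ h₀·(d·R^d·Kf(δ_H))·|u|²` (absolute row sums by `abs_rowSum_le_of_entry_decay_par`; road P3's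
Schur test `form_le_of_abs_rowSum_le`). [folklore] -/
theorem form_le_of_entry_decay_par (hH : Hᵀ = H)
    (hKf : ∀ s : ℝ, 0 < s → ∀ y : Tor (fine N M), ∑ y' : Tor (fine N M), Real.exp (-(s * (tdist y y' : ℝ))) ≤ Kf s)
    {h₀ δH : ℝ} (hh₀ : 0 ≤ h₀) (hδH : 0 < δH)
    (hHent : ∀ x x', |H x x'| ≤ h₀ * Real.exp (-(δH * (tdist (par N R M x.1) (par N R M x'.1) : ℝ)))) (u : Tor (fine (R * N) M) × Fin d → ℝ) :
    u ⬝ᵥ (H *ᵥ u) ≤ h₀ * ((d : ℝ) * (R : ℝ) ^ d * Kf δH) * (u ⬝ᵥ u) :=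
  form_le_of_abs_rowSum_le hH (fun x => abs_rowSum_le_of_entry_decay_par N R M hKf hh₀ hδH hHent x) u

end Schur

/-! ## §3 The axial tree avoids the top corners -/

section Tree

omit [NeZero N] hM in
/-- **`not_corner_of_tree`** — PART 180's letter `hι` for the axial tree: a tree bond `(x, μ)` (`rem_μ x + 1 < R`) is never a top-corner bond (`rem ≡ R − 1`), so PART 168's corner lift
vanishes on the tree (PART 178 `cornerLift_apply_of_tree` says the same bondwise). [folklore] -/
theorem not_corner_of_tree
    (t : {x : Tor (fine (R * N) M) × Fin d // (∀ ν, ν < x.2 → ((rem N R M x.1 ν : ℕ)) = 0) ∧ ((rem N R M x.1 x.2 : ℕ)) + 1 < R}) :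
    ¬ (∀ ν, ((rem N R M
      ((Function.Embedding.subtype (fun x : Tor (fine (R * N) M) × Fin d => (∀ ν, ν < x.2 → ((rem N R M x.1 ν : ℕ)) = 0) ∧ ((rem N R M x.1 x.2 : ℕ)) + 1 < R)) t).1
        ν : ℕ)) = R - 1) := by
  intro h
  have h1 : ((rem N R M t.1.1 t.1.2 : ℕ)) = R - 1 := h t.1.2
  have h2 := t.2.2
  omega

end Tree

end Summit.QuantumFields.BalabanUV.Beta.GAN24.OneStepConstraintBlockGeometry

end
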